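import Summits.CriticalPhenomena.PercolationContinuityZ3.Theorems.Transplant.SkelPhiWinChainF2
import Summits.CriticalPhenomena.PercolationContinuityZ3.Theorems.Transplant.KNLevelsChainTransfer
import Summits.CriticalPhenomena.PercolationContinuityZ3.Theorems.Transplant.SkelRouteLaw
import HarnessLib

/-!
# N1 ({±1} node), (F) inner route, part R2 (hp-8 g33): THE TARGET CHAIN OVER TWO WINDOWS, APPLIED — p5-g8's `WinChainData.chain₂` (C-N1: the
# linked two-segment step family, `KitsAt` per step, rim excess, end identities) combined with the KNLevels chain property, a source bound on the
# first core and a domination of the last true target: **`WinChainData.lt_real_of_chainF₂`** (two-frame twin of p1-g11's `lt_real_of_chainF`),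
# and its ROUTE-LAW form **`lt_real_linkIn_of_chainF₂`**: under hp-8 g24's `Skel.routeW G Wt Qt S` (seed `S` wired, cut to the route world `Qt`)
# the chain gives `1 − ε < P_{Wt}(linkIn Qt S Ft)` — the shape of the route datum (h3) of p1-g11's `kitClauseA'` for a FACE-STEP kit, whose
# target is many strides away (hop + bridge + band per near contact, F-COLUMN-N1-PLAN addendum 2 / lane 2026-08-21 16:5xZ)

builds on p205010 (kernel theorem, internal audit signed; external expert review pending) — nothing in this file uses p205010; nothing here is a
claim about the open node `SamePDropOfSkeletonNeg`.
Lane `prim-bschramm`, seat `prim-hp-8` (gen 33); helper file (`--supports stmt-CriticalPhenomena-4575 --as helper`).  Generic over the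
exploration graph `G'`, the two planar windows, the two frames, the weighting.
* **`WinChainData.lt_real_of_chainF₂`** — `chain₂`'s hypotheses + `hchain` (length `S₁.N + 1 + S₂.N`, accuracy `δ ↦ ε`) + `hB₀ : B₀ ⊆ 𝒲₁.W (S₁.core 0)`,
  `hsrc : 1 − δ < P_{W'}(⋃_{t ∈ B₀} o ↔ t)`, `hTn : 𝒲₂.coreTF S₂ S₂.N ⊆ Ft`, `hdom : P_{W'}(⋃_{t ∈ Ft} o ↔ t) ≤ μA` ⟹ `1 − ε < μA`;
* **`WinChainData.lt_real_linkIn_of_chainF₂`** — the same at `W' := Skel.routeW G Wt Qt S`, `o ∈ S ⊆ Qt`, `Disjoint S Ft` ⟹ `1 − ε < P_{Wt}(linkIn Qt S Ft)`.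
[cite: KozmaNitzan2024, §4 Lemma 11 (pp. 22–23), Lemma 12 (pp. 23–25), p. 20 (Step IV), p. 24 (P(o ↔^A ·))]
-/

noncomputable section

open MeasureTheory ProbabilityTheory
open scoped ENNReal

namespace Summit.CriticalPhenomena.PercolationContinuityZ3.Theorems.Transplant

namespace Skelφ

open Literature.Probability.Percolation Literature.Probability.LatticeModels SimpleGraph
open Literature.Probability.Percolation.KozmaNitzan
open KNLevels ChainPlanar

variable {V : Type} [DecidableEq V]

namespace WinChainData

variable {G' : SimpleGraph V} [G'.LocallyFinite]
variable (P₁ P₂ : WinChainData V) (𝒲₁ 𝒲₂ : PlanarWindow G') (S₁ S₂ : SchedFrame)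

/-- **THE TARGET CHAIN OVER TWO WINDOWS, APPLIED**: `chain₂` + the chain property of length `S₁.N + 1 + S₂.N` at `(δ ↦ ε)` + a source bound
`1 − δ < P_{W'}(⋃_{t ∈ B₀} o ↔ t)` on a part `B₀` of the first core window + the last true target inside `Ft` with `P_{W'}(⋃_{t ∈ Ft} o ↔ t) ≤ μA`
⟹ `1 − ε < μA`. [cite: KozmaNitzan2024, §4 Lemma 11 (pp. 22–23), Lemma 12 (pp. 23–25), p. 20 (Step IV)] -/
theorem lt_real_of_chainF₂ (ho : P₂.o = P₁.o)
    (hRl₁ : P₁.Rlev + 1 ≤ S₁.R') (hRim₁ : ∀ k, P₁.Rim k ⊆ 𝒲₁.stepDF S₁ k) (hTne₁ : ∀ k ≤ S₁.N, (𝒲₁.coreTF S₁ k).Nonempty)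
    (hRl₂ : P₂.Rlev + 1 ≤ S₂.R') (hRim₂ : ∀ k, P₂.Rim k ⊆ 𝒲₂.stepDF S₂ k) (hTne₂ : ∀ k ≤ S₂.N, (𝒲₂.coreTF S₂ k).Nonempty)
    (hx : 𝒲₁.coreTF S₁ S₁.N ⊆ 𝒲₂.W (S₂.core 0))
    {p : unitInterval} {W' : Sym2 V → unitInterval} {Δ' : ℕ} {δ ε η : ℝ} {B₀ Ft : Finset V} {μA : ℝ}
    (hchain : ∀ (W : Sym2 V → unitInterval) (s : Fin (S₁.N + 1 + S₂.N + 1) → TStep G') (T' : Fin (S₁.N + 1 + S₂.N + 1) → Finset V) (η : ℝ),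
      (∀ i, (s i).L.o = (s 0).L.o) →
      (∀ i : Fin (S₁.N + 1 + S₂.N), T' (Fin.castSucc i) ⊆ (s i.succ).L.X 0) →
      (∀ i, T' i ⊆ (s i).T) →
      (∀ i, (s i).KitsAt W p Δ' δ) →
      η ≤ δ / 2 →
      (∀ i, (prodBernoulli W).real (⋃ t ∈ (s i).T \ T' i, openConn (s 0).L.o t) ≤ η) →
      1 - δ < (prodBernoulli W).real (s 0).L.reachB →
        1 - ε < (prodBernoulli W).real (⋃ t ∈ T' (Fin.last (S₁.N + 1 + S₂.N)), openConn (s 0).L.o t))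
    (hsub₁ : ∀ k ≤ S₁.N, IsSubbox G' W' p (𝒲₁.stepDF S₁ k)) (hfin₁ : FinSupp W' P₁.Sfin) (hDS₁ : ∀ k ≤ S₁.N, 𝒲₁.stepDF S₁ k ⊆ P₁.Sfin)
    (ho₁ : ∀ k ≤ S₁.N, P₁.o ∉ 𝒲₁.stepDF S₁ k) (hoS₁ : P₁.o ∈ P₁.Sfin) (hj₁ : P₁.j₁ ≤ P₁.Rlev)
    (hcount₁ : 1 / (1 - (p : ℝ)) ^ (Δ' * P₁.N) ≤ δ * ((Finset.Icc P₁.j₀ P₁.j₁).card : ℝ))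
    (hkits₁ : ∀ k ≤ S₁.N, ∀ j ∈ Finset.Icc P₁.j₀ P₁.j₁, ∃ (σ : SData V) (Sz : Finset V),
      SHyp (P₁.stepLF 𝒲₁ S₁ k) j σ ∧ σ.N ≤ P₁.N ∧
      (1 - (p : ℝ) ^ σ.sB) ^ σ.k ≤ δ ∧ Sz ⊆ (P₁.stepLF 𝒲₁ S₁ k).X j ∧ Sz ⊆ 𝒲₁.stepDF S₁ k ∧
      (∀ x ∈ σ.K, ∀ e ∈ σ.seed x, e ∉ wireSet (↑Sz : Set V)) ∧ (∀ x ∈ σ.K, σ.face x ⊆ Sz) ∧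
      (∀ x ∈ σ.K, 1 - 3 * δ ≤ (prodBernoulli W').real {ω | ∃ u ∈ σ.face x,
        1 - δ < (prodBernoulli (pinW W' (wireSet (↑Sz : Set V)) ω)).real
          (⋃ t ∈ P₁.coreEF 𝒲₁ S₁ k, openConnIn (↑(𝒲₁.stepDF S₁ k) : Set V) u t)}))
    (hexc₁ : ∀ k ≤ S₁.N, (prodBernoulli W').real (⋃ t ∈ P₁.Rim k, openConn P₁.o t) ≤ η)
    (hsub₂ : ∀ k ≤ S₂.N, IsSubbox G' W' p (𝒲₂.stepDF S₂ k)) (hfin₂ : FinSupp W' P₂.Sfin) (hDS₂ : ∀ k ≤ S₂.N, 𝒲₂.stepDF S₂ k ⊆ P₂.Sfin)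
    (ho₂ : ∀ k ≤ S₂.N, P₂.o ∉ 𝒲₂.stepDF S₂ k) (hoS₂ : P₂.o ∈ P₂.Sfin) (hj₂ : P₂.j₁ ≤ P₂.Rlev)
    (hcount₂ : 1 / (1 - (p : ℝ)) ^ (Δ' * P₂.N) ≤ δ * ((Finset.Icc P₂.j₀ P₂.j₁).card : ℝ))
    (hkits₂ : ∀ k ≤ S₂.N, ∀ j ∈ Finset.Icc P₂.j₀ P₂.j₁, ∃ (σ : SData V) (Sz : Finset V),
      SHyp (P₂.stepLF 𝒲₂ S₂ k) j σ ∧ σ.N ≤ P₂.N ∧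
      (1 - (p : ℝ) ^ σ.sB) ^ σ.k ≤ δ ∧ Sz ⊆ (P₂.stepLF 𝒲₂ S₂ k).X j ∧ Sz ⊆ 𝒲₂.stepDF S₂ k ∧
      (∀ x ∈ σ.K, ∀ e ∈ σ.seed x, e ∉ wireSet (↑Sz : Set V)) ∧ (∀ x ∈ σ.K, σ.face x ⊆ Sz) ∧
      (∀ x ∈ σ.K, 1 - 3 * δ ≤ (prodBernoulli W').real {ω | ∃ u ∈ σ.face x,
        1 - δ < (prodBernoulli (pinW W' (wireSet (↑Sz : Set V)) ω)).real
          (⋃ t ∈ P₂.coreEF 𝒲₂ S₂ k, openConnIn (↑(𝒲₂.stepDF S₂ k) : Set V) u t)}))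
    (hexc₂ : ∀ k ≤ S₂.N, (prodBernoulli W').real (⋃ t ∈ P₂.Rim k, openConn P₁.o t) ≤ η) (hη : η ≤ δ / 2)
    (hB₀ : B₀ ⊆ 𝒲₁.W (S₁.core 0)) (hsrc : 1 - δ < (prodBernoulli W').real (⋃ t ∈ B₀, openConn P₁.o t))
    (hTn : 𝒲₂.coreTF S₂ S₂.N ⊆ Ft) (hdom : (prodBernoulli W').real (⋃ t ∈ Ft, openConn P₁.o t) ≤ μA) :
    1 - ε < μA := by
  obtain ⟨hos, hlink, hT, hkits, hexc, hX0, hlast⟩ := chain₂ P₁ P₂ 𝒲₁ 𝒲₂ S₁ S₂ ho hRl₁ hRim₁ hTne₁ hRl₂ hRim₂ hTne₂ hx hsub₁ hfin₁ hDS₁ ho₁ hoS₁ hj₁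
    hcount₁ hkits₁ hexc₁ hsub₂ hfin₂ hDS₂ ho₂ hoS₂ hj₂ hcount₂ hkits₂ hexc₂
  have hB₀' : B₀ ⊆ (P₁.stepLF 𝒲₁ S₁ 0).X 0 := by rw [P₁.stepLF_X_zero]; exact hB₀
  refine lt_real_of_chain G' hchain (fun i => stepAF₂ P₁ P₂ 𝒲₁ 𝒲₂ S₁ S₂ i) (fun i => coreTF₂ 𝒲₁ 𝒲₂ S₁ S₂ i) hos hlink hT hkits hη hexc
    ?_ (by rw [Fin.val_last, coreTF₂_right]; exact hTn) hdom
  -- the source bound: `B₀` lies in the first level of the first step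
  refine hsrc.trans_le (measureReal_mono ?_ (measure_ne_top _ _))
  intro ω hω
  simp only [Set.mem_iUnion, exists_prop] at hω
  obtain ⟨t, ht, hωt⟩ := hω
  show ω ∈ (stepAF₂ P₁ P₂ 𝒲₁ 𝒲₂ S₁ S₂ ((0 : Fin (S₁.N + 1 + S₂.N + 1)) : ℕ)).L.reachB
  rw [Fin.val_zero, stepAF₂_left _ _ _ _ _ _ (Nat.zero_le _)]
  show ω ∈ (P₁.stepLF 𝒲₁ S₁ 0).reachB
  exact Set.mem_biUnion (Finset.mem_coe.2 (hB₀' ht)) hωt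

/-- **THE ROUTE DATUM FROM A TWO-FRAME CHAIN** (the shape of (h3) of `kitClauseA'` for a face-step kit): under the route law
`W' := Skel.routeW G Wt Qt S` (seed `S ∋ o` wired, cut to `Qt ⊇ S`), the hypotheses of `lt_real_of_chainF₂` with the last true target inside `Ft`
(`Disjoint S Ft`) give `1 − ε < P_{Wt}(linkIn Qt S Ft)`. [cite: KozmaNitzan2024, §4 Lemma 11 (p. 22), p. 24 (P(o ↔^A ·)), p. 20 (Step IV)] -/
theorem lt_real_linkIn_of_chainF₂ [Countable V] (G : SimpleGraph V) [G.LocallyFinite] (ho : P₂.o = P₁.o)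
    (hRl₁ : P₁.Rlev + 1 ≤ S₁.R') (hRim₁ : ∀ k, P₁.Rim k ⊆ 𝒲₁.stepDF S₁ k) (hTne₁ : ∀ k ≤ S₁.N, (𝒲₁.coreTF S₁ k).Nonempty)
    (hRl₂ : P₂.Rlev + 1 ≤ S₂.R') (hRim₂ : ∀ k, P₂.Rim k ⊆ 𝒲₂.stepDF S₂ k) (hTne₂ : ∀ k ≤ S₂.N, (𝒲₂.coreTF S₂ k).Nonempty)
    (hx : 𝒲₁.coreTF S₁ S₁.N ⊆ 𝒲₂.W (S₂.core 0))
    {p : unitInterval} {Wt : Sym2 V → unitInterval} {Qt S : Finset V} {Δ' : ℕ} {δ ε η : ℝ} {B₀ Ft : Finset V}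
    (hchain : ∀ (W : Sym2 V → unitInterval) (s : Fin (S₁.N + 1 + S₂.N + 1) → TStep G') (T' : Fin (S₁.N + 1 + S₂.N + 1) → Finset V) (η : ℝ),
      (∀ i, (s i).L.o = (s 0).L.o) →
      (∀ i : Fin (S₁.N + 1 + S₂.N), T' (Fin.castSucc i) ⊆ (s i.succ).L.X 0) →
      (∀ i, T' i ⊆ (s i).T) →
      (∀ i, (s i).KitsAt W p Δ' δ) →
      η ≤ δ / 2 →
      (∀ i, (prodBernoulli W).real (⋃ t ∈ (s i).T \ T' i, openConn (s 0).L.o t) ≤ η) →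
      1 - δ < (prodBernoulli W).real (s 0).L.reachB →
        1 - ε < (prodBernoulli W).real (⋃ t ∈ T' (Fin.last (S₁.N + 1 + S₂.N)), openConn (s 0).L.o t))
    (hsub₁ : ∀ k ≤ S₁.N, KNLevels.IsSubbox G' (Skel.routeW G Wt Qt S) p (𝒲₁.stepDF S₁ k)) (hfin₁ : KNLevels.FinSupp (Skel.routeW G Wt Qt S) P₁.Sfin)
    (hDS₁ : ∀ k ≤ S₁.N, 𝒲₁.stepDF S₁ k ⊆ P₁.Sfin) (ho₁ : ∀ k ≤ S₁.N, P₁.o ∉ 𝒲₁.stepDF S₁ k) (hoS₁ : P₁.o ∈ P₁.Sfin) (hj₁ : P₁.j₁ ≤ P₁.Rlev)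
    (hcount₁ : 1 / (1 - (p : ℝ)) ^ (Δ' * P₁.N) ≤ δ * ((Finset.Icc P₁.j₀ P₁.j₁).card : ℝ))
    (hkits₁ : ∀ k ≤ S₁.N, ∀ j ∈ Finset.Icc P₁.j₀ P₁.j₁, ∃ (σ : SData V) (Sz : Finset V),
      SHyp (P₁.stepLF 𝒲₁ S₁ k) j σ ∧ σ.N ≤ P₁.N ∧
      (1 - (p : ℝ) ^ σ.sB) ^ σ.k ≤ δ ∧ Sz ⊆ (P₁.stepLF 𝒲₁ S₁ k).X j ∧ Sz ⊆ 𝒲₁.stepDF S₁ k ∧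
      (∀ x ∈ σ.K, ∀ e ∈ σ.seed x, e ∉ wireSet (↑Sz : Set V)) ∧ (∀ x ∈ σ.K, σ.face x ⊆ Sz) ∧
      (∀ x ∈ σ.K, 1 - 3 * δ ≤ (prodBernoulli (Skel.routeW G Wt Qt S)).real {ω | ∃ u ∈ σ.face x,
        1 - δ < (prodBernoulli (pinW (Skel.routeW G Wt Qt S) (wireSet (↑Sz : Set V)) ω)).real
          (⋃ t ∈ P₁.coreEF 𝒲₁ S₁ k, openConnIn (↑(𝒲₁.stepDF S₁ k) : Set V) u t)}))
    (hexc₁ : ∀ k ≤ S₁.N, (prodBernoulli (Skel.routeW G Wt Qt S)).real (⋃ t ∈ P₁.Rim k, openConn P₁.o t) ≤ η)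
    (hsub₂ : ∀ k ≤ S₂.N, KNLevels.IsSubbox G' (Skel.routeW G Wt Qt S) p (𝒲₂.stepDF S₂ k)) (hfin₂ : KNLevels.FinSupp (Skel.routeW G Wt Qt S) P₂.Sfin)
    (hDS₂ : ∀ k ≤ S₂.N, 𝒲₂.stepDF S₂ k ⊆ P₂.Sfin) (ho₂ : ∀ k ≤ S₂.N, P₂.o ∉ 𝒲₂.stepDF S₂ k) (hoS₂ : P₂.o ∈ P₂.Sfin) (hj₂ : P₂.j₁ ≤ P₂.Rlev)
    (hcount₂ : 1 / (1 - (p : ℝ)) ^ (Δ' * P₂.N) ≤ δ * ((Finset.Icc P₂.j₀ P₂.j₁).card : ℝ))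
    (hkits₂ : ∀ k ≤ S₂.N, ∀ j ∈ Finset.Icc P₂.j₀ P₂.j₁, ∃ (σ : SData V) (Sz : Finset V),
      SHyp (P₂.stepLF 𝒲₂ S₂ k) j σ ∧ σ.N ≤ P₂.N ∧
      (1 - (p : ℝ) ^ σ.sB) ^ σ.k ≤ δ ∧ Sz ⊆ (P₂.stepLF 𝒲₂ S₂ k).X j ∧ Sz ⊆ 𝒲₂.stepDF S₂ k ∧
      (∀ x ∈ σ.K, ∀ e ∈ σ.seed x, e ∉ wireSet (↑Sz : Set V)) ∧ (∀ x ∈ σ.K, σ.face x ⊆ Sz) ∧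
      (∀ x ∈ σ.K, 1 - 3 * δ ≤ (prodBernoulli (Skel.routeW G Wt Qt S)).real {ω | ∃ u ∈ σ.face x,
        1 - δ < (prodBernoulli (pinW (Skel.routeW G Wt Qt S) (wireSet (↑Sz : Set V)) ω)).real
          (⋃ t ∈ P₂.coreEF 𝒲₂ S₂ k, openConnIn (↑(𝒲₂.stepDF S₂ k) : Set V) u t)}))
    (hexc₂ : ∀ k ≤ S₂.N, (prodBernoulli (Skel.routeW G Wt Qt S)).real (⋃ t ∈ P₂.Rim k, openConn P₁.o t) ≤ η) (hη : η ≤ δ / 2)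
    (hB₀ : B₀ ⊆ 𝒲₁.W (S₁.core 0)) (hsrc : 1 - δ < (prodBernoulli (Skel.routeW G Wt Qt S)).real (⋃ t ∈ B₀, openConn P₁.o t))
    (hTn : 𝒲₂.coreTF S₂ S₂.N ⊆ Ft) (hSQ : S ⊆ Qt) (hSF : Disjoint S Ft) (hoS : P₁.o ∈ S) :
    1 - ε < (prodBernoulli Wt).real (linkIn (↑Qt : Set V) S Ft) :=
  lt_real_of_chainF₂ P₁ P₂ 𝒲₁ 𝒲₂ S₁ S₂ ho hRl₁ hRim₁ hTne₁ hRl₂ hRim₂ hTne₂ hx hchain hsub₁ hfin₁ hDS₁ ho₁ hoS₁ hj₁ hcount₁ hkits₁ hexc₁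
    hsub₂ hfin₂ hDS₂ ho₂ hoS₂ hj₂ hcount₂ hkits₂ hexc₂ hη hB₀ hsrc hTn (Skel.real_biUnion_openConn_routeW_le_linkIn G Wt hSQ hSF hoS)

end WinChainData

end Skelφ

end Summit.CriticalPhenomena.PercolationContinuityZ3.Theorems.Transplant

end
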